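import Summits.BirchSwinnertonDyer.BirchSwinnertonDyer.Theorems.SmallImageMuTransferMuTransferX9LocalTwistOperator
import Summits.BirchSwinnertonDyer.BirchSwinnertonDyer.Theorems.SmallImageMuTransferMuTransferX9SplitPrimeCongruence
import Summits.BirchSwinnertonDyer.Rank1Residual.GaloisImage.TateModuleEulerFactor
import Literature.NumberTheory.EllipticCurves.Kato2004.IwasawaH1Reduction
import Literature.NumberTheory.EllipticCurves.SupersingularDensitySerreTraceProofs
import Literature.NumberTheory.Automorphic.ThorneQInfinityModularSurjectivityProofs
import Literature.NumberTheory.GaloisRepresentations.EulerSystem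
import HarnessLib

/-!
# K6 crux `MuTransferX9` (stmt-BirchSwinnertonDyer-19276), stub `stub_stepsTwoFourOdd`, input G3a:
# the Euler factor MODULO `p` — `red ∘ P(Fr⁻¹) = P̄(Fr⁻¹) ∘ red` across the change of coefficient
# rings `ℤ_p ⟶ ℤ` (`T_pW ⟶ W[p]`)

Cell `bsd-smallim`, seat `bsd-smallim-k6-lur-a` (gen 0; G3a co-hand of koly g9, file (ii) of koly's
TAKEN 2026-08-26T17:50Z plan).  HONEST FRAMING: theorems only (no definition, no named fact, no
`sorry`); nothing is asserted about any curve and nothing is booked.  `--supports` helper toward the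
registered stub `stub_stepsTwoFourOdd` of skeleton v6 (sha16 a90a661b046bb403) of crux 19276, input
G3a = the GENUINE tame class (koly g9 `…X9TameClass.lean`): the norm relation of a `Λ`-adic Euler
system `cores z_{n,q} = P_Fr(Fr⁻¹) · z_n` (tree `IsEulerSystem.cores_cons`, `eulerFactorOp`) lives in
`H¹(U, T_pW)` over `ℤ_p`; the Kolyvagin argument of MU-TRANSFER-PROOF §3 runs in `H¹(U, W[p])` over
`ℤ`, reached by Kato's reduction `Kato2004.reduceH1` (§13.8, `T ⟶ T/p`), an ADDITIVE map between
cohomology groups with DIFFERENT coefficient rings — so the tree's same-ring transport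
(`GaloisImage.Derivative.sum_conjMap_pow_red_eq_aeval`, `apply_aeval_apply_eq_of_comm`) does not apply.
This file supplies the missing bookkeeping:

* §1 `reduceH1_smul` — `red (a • c) = (a mod p) • red c` for `a ∈ ℤ_p` ("coefficientwise
  `a = (a mod p) + p·b`": `PadicInt.ker_toZMod`, `reduceH1_natCast_smul`); and `p · H¹(U, W[p]) = 0`.
* §2 `reduceH1_frobeniusInvOp(_pow)` — `red ∘ Fr⁻¹ = Fr⁻¹ ∘ red` (`reduceH1_conjMap`).
* §3 **`reduceH1_aeval_frobeniusInvOp`** — for `P ∈ ℤ_p[X]` and any `P̄ ∈ ℤ[X]` reducing to the same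
  polynomial over `𝔽_p`: `red (P(Fr⁻¹) c) = P̄(Fr⁻¹) (red c)`; specialisation `reduceH1_eulerFactorOp`.
* §4 **`map_toZMod_rubinEulerFactor_eq_of_galoisRepTorsion_eq_one`** — at a good place `v ∤ p` with an
  `E`-SPLIT arithmetic Frobenius (`ρ̄_{E,p}(Fr) = 1`), Rubin's factor `1 − (a_q/q)X + (1/q)X²`
  (b2b `Rat.rubinEulerFactor_galoisRepTate`) reduces to `(1 − X)²`: `a_q ≡ 2` (Serre (238) +
  `tr ρ̄(Fr) = 1 + χ̄_p(Fr)`) and `q ≡ 1` (x9 `SplitPrime`).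
* §5 **`exists_aeval_unipotentPow_eq_shiftEnd_pow_mul_unit`** — operator form on `𝒯_J = Fin J → M`:
  `P̄((1+S)^{pᵐu}) = S^{2pᵐ}·(unit)` for `p ∤ u` (koly's (F5) squared), plus the congruence invariance
  `aeval_eq_aeval_of_map_castRingHom_eq`.

PARTITION (D-0054): X9 (A4) × p ∈ {5,7} (+ X10b∧¬Surj at p = 3 via v6) — helper toward
`stub_stepsTwoFourOdd` (input G3a); closes none.

References: K. Kato, Astérisque 295 (2004) §13.8 p. 228, (13.1.1) p. 224 [Kato2004Asterisque]; K. Rubin,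
*Euler Systems* (2000) Def. 2.1.1, Lemma 4.4.2 [Rubin2000]; J.-P. Serre, *Quelques applications du théorème
de densité de Chebotarev*, Publ. Math. IHÉS 54 (1981) (238) [Serre1981]; J.-P. Serre, Invent. Math. 15 (1972)
§1.11 [Serre1972]; L. Washington, *Introduction to Cyclotomic Fields* §13.2 [Washington1997];
HOME/koly/MU-TRANSFER-PROOF.md §3, (F5).
-/

set_option linter.dupNamespace false
set_option autoImplicit false

noncomputable section

open scoped NumberField
open Polynomial Field IsDedekindDomain CategoryTheory
open Literature.NumberTheory.GaloisRepresentations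
open Literature.NumberTheory.EllipticCurves Literature.NumberTheory.EllipticCurves.Kato2004
open Literature.NumberTheory.EllipticCurves.Kato2004.EulerSystemValues
open WeierstrassCurve (geomPoints geomTorsion)

namespace Summit.BirchSwinnertonDyer.BirchSwinnertonDyer.Rank1Residual.EulerFactorModP

variable (W : WeierstrassCurve ℚ) [W.IsElliptic] (p : ℕ) [Fact p.Prime]
  [ContinuousSMul ℤ_[p] (W.tateModule p)] (U : Subgroup (absoluteGaloisGroup ℚ))

/-! ## §1 Scalars: `p · H¹(U, W[p]) = 0` and `red (a • c) = (a mod p) • red c` -/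

omit [W.IsElliptic] [Fact p.Prime] [ContinuousSMul ℤ_[p] (W.tateModule p)] in
/-- `p` kills `H¹(U, W[p])` (every class is the class of a crossed homomorphism with values in the
`p`-torsion `W[p]`). [cite: Kato2004Asterisque, §13.8 (p. 228)] -/
theorem prime_nsmul_eq_zero (y : H1 (W.torsionGaloisModule (p : ℤ)) U) : p • y = 0 := by
  obtain ⟨φ, rfl⟩ := oneCocycleClass_surjective _ y
  have hφ : (p : ℤ) • φ = 0 := by
    refine Subtype.ext (ContinuousMap.ext fun g => ?_)
    change (p : ℤ) • φ.1 g = 0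
    rw [natCast_zsmul]
    exact AddSubgroup.torsionBy.nsmul (φ.1 g)
  change p • oneCocycleClass _ φ =
    (0 : ↥(continuousCohomology 1 (subgroupRep (W.torsionGaloisModule (p : ℤ)).toTopRep U)))
  rw [← Nat.cast_smul_eq_nsmul ℤ, ← oneCocycleClass_smul, hφ, oneCocycleClass_zero]

omit [W.IsElliptic] [ContinuousSMul ℤ_[p] (W.tateModule p)] in
/-- An integer `z` acts on `H¹(U, W[p])` (through the `ℤ`-module structure of the cohomology of a
`ℤ`-linear representation) as the natural number `(z mod p)`. [folklore] -/
theorem int_smul_eq_val_nsmul (z : ℤ) (y : H1 (W.torsionGaloisModule (p : ℤ)) U) :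
    z • y = ((z : ZMod p)).val • y := by
  haveI : NeZero p := ⟨(Fact.out : p.Prime).ne_zero⟩
  have hval : ((((z : ZMod p)).val : ℕ) : ℤ) = z % (p : ℤ) := ZMod.val_intCast z
  have hz : z = (((z : ZMod p)).val : ℤ) + (p : ℤ) * (z / (p : ℤ)) := by
    rw [hval]; exact (Int.emod_add_mul_ediv z p).symm
  have h0 : ((p : ℤ) * (z / (p : ℤ))) • y = 0 := by
    rw [mul_zsmul, natCast_zsmul, prime_nsmul_eq_zero W p U ((z / (p : ℤ)) • y)]
  conv_lhs => rw [hz]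
  rw [add_zsmul, h0, add_zero, natCast_zsmul]

/-- **`red (a • c) = (a mod p) • red c`** for `a ∈ ℤ_p`: write `a = (a mod p) + p·b`; `red` is additive
and kills `p·H¹(U, T_pW)` (`reduceH1_natCast_smul`). [cite: Kato2004Asterisque, §13.8 (p. 228)] -/
theorem reduceH1_smul (a : ℤ_[p]) (c : H1 (tateRep W p) U) :
    reduceH1 W p U (a • c) = (PadicInt.toZMod a).val • reduceH1 W p U c := by
  -- `a - (a mod p) ∈ ker (ℤ_p → 𝔽_p) = (p)`
  have hker : a - ((PadicInt.toZMod a).val : ℤ_[p]) ∈ RingHom.ker (PadicInt.toZMod (p := p)) := by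
    rw [RingHom.mem_ker, map_sub, map_natCast, ZMod.natCast_zmod_val, sub_self]
  rw [PadicInt.ker_toZMod, PadicInt.maximalIdeal_eq_span_p, Ideal.mem_span_singleton'] at hker
  obtain ⟨b, hb⟩ := hker
  have ha : a • c = ((PadicInt.toZMod a).val : ℤ_[p]) • c + (p : ℤ_[p]) • (b • c) := by
    rw [← mul_smul, ← add_smul, mul_comm, hb, add_sub_cancel]
  rw [ha, map_add, reduceH1_natCast_smul, add_zero, Nat.cast_smul_eq_nsmul, map_nsmul]

/-! ## §2 `red` commutes with `Fr⁻¹` -/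

variable [U.Normal]

/-- **`red ∘ Fr⁻¹ = Fr⁻¹ ∘ red`**: Rubin's operator `frobeniusInvOp T U σ = conj_{σ⁻¹}` on `H¹(U, ·)`
commutes with the reduction `T_pW → W[p]` (`reduceH1_conjMap`). [cite: Kato2004Asterisque, §13.8 (p. 228)] -/
theorem reduceH1_frobeniusInvOp (σ : absoluteGaloisGroup ℚ) (c : H1 (tateRep W p) U) :
    reduceH1 W p U (frobeniusInvOp (tateRep W p) U σ c) =
      frobeniusInvOp (W.torsionGaloisModule (p : ℤ)) U σ (reduceH1 W p U c) :=
  reduceH1_conjMap W p U σ⁻¹ c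

/-- Iterated form: `red ∘ (Fr⁻¹)^i = (Fr⁻¹)^i ∘ red`. [cite: Kato2004Asterisque, §13.8 (p. 228)] -/
theorem reduceH1_frobeniusInvOp_pow (σ : absoluteGaloisGroup ℚ) (i : ℕ) (c : H1 (tateRep W p) U) :
    reduceH1 W p U ((frobeniusInvOp (tateRep W p) U σ ^ i) c) =
      (frobeniusInvOp (W.torsionGaloisModule (p : ℤ)) U σ ^ i) (reduceH1 W p U c) := by
  induction i generalizing c with
  | zero => rfl
  | succ i ih =>
    rw [pow_succ, pow_succ, Module.End.mul_apply, Module.End.mul_apply, ih, reduceH1_frobeniusInvOp]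

/-! ## §3 `red ∘ P(Fr⁻¹) = P̄(Fr⁻¹) ∘ red` -/

/-- **The Euler-factor operator modulo `p`.**  For `P ∈ ℤ_p[X]` and ANY integer polynomial `P̄`
with the same reduction over `𝔽_p` (`P.map (ℤ_p → 𝔽_p) = P̄.map (ℤ → 𝔽_p)`), and every
`c ∈ H¹(U, T_pW)`: `red (P(Fr⁻¹) c) = P̄(Fr⁻¹) (red c)` in `H¹(U, W[p])` — `red` is additive, commutes
with `Fr⁻¹`, and carries `a ∈ ℤ_p` to `a mod p` (§1), while `H¹(U, W[p])` is killed by `p`.  This is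
the change of coefficients `T → T/p` of Kato §13.8 applied to the Euler factor `P(Fr_q⁻¹ | T*; Fr_q⁻¹)`
of the norm relation (13.1.1) / Rubin Def. 2.1.1. [cite: Kato2004Asterisque, §13.8 (p. 228) and (13.1.1) (p. 224)]
[cite: Rubin2000, Def. 2.1.1] -/
theorem reduceH1_aeval_frobeniusInvOp (σ : absoluteGaloisGroup ℚ) {P : ℤ_[p][X]} {Pbar : ℤ[X]}
    (hP : P.map (PadicInt.toZMod (p := p)) = Pbar.map (Int.castRingHom (ZMod p)))
    (c : H1 (tateRep W p) U) :
    reduceH1 W p U (aeval (frobeniusInvOp (tateRep W p) U σ) P c) =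
      aeval (frobeniusInvOp (W.torsionGaloisModule (p : ℤ)) U σ) Pbar (reduceH1 W p U c) := by
  -- a common summation bound
  set n : ℕ := max P.natDegree Pbar.natDegree + 1 with hn
  have hPn : P.natDegree < n := by omega
  have hPbn : Pbar.natDegree < n := by omega
  rw [aeval_eq_sum_range' hPn, aeval_eq_sum_range' hPbn]
  simp only [LinearMap.sum_apply, LinearMap.smul_apply, map_sum]
  refine Finset.sum_congr rfl fun i _ => ?_
  -- coefficient `i`: `toZMod (P.coeff i) = (Pbar.coeff i : 𝔽_p)`
  have hi : PadicInt.toZMod (P.coeff i) = ((Pbar.coeff i : ℤ) : ZMod p) := by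
    have h := congrArg (fun Q : (ZMod p)[X] => Q.coeff i) hP
    simpa only [coeff_map, Int.coe_castRingHom] using h
  rw [reduceH1_smul, reduceH1_frobeniusInvOp_pow, Algebra.smul_def, eq_intCast, Module.End.mul_apply,
    Module.End.intCast_apply, int_smul_eq_val_nsmul W p U (Pbar.coeff i), ← hi]

/-- **`red ∘ P(Fr_q⁻¹ | T_pW*; Fr_q⁻¹) = P̄(Fr_q⁻¹) ∘ red`** for Rubin's Euler-factor operator
`eulerFactorOp` of the `Λ`-adic Euler system (the right-hand side of `IsEulerSystem.cores_cons`) and any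
integral model `P̄` of its reduction. [cite: Rubin2000, Def. 2.1.1] [cite: Kato2004Asterisque, §13.8 (p. 228)] -/
theorem reduceH1_eulerFactorOp [Module.Free ℤ_[p] (W.tateModule p)] [Module.Finite ℤ_[p] (W.tateModule p)]
    (σ : absoluteGaloisGroup ℚ) {Pbar : ℤ[X]}
    (hP : (rubinEulerFactor (tateRep W p).toRepresentation (cyclotomicCharacterToUnits ℚ p ℤ_[p]) σ).map
        (PadicInt.toZMod (p := p)) = Pbar.map (Int.castRingHom (ZMod p)))
    (c : H1 (tateRep W p) U) :
    reduceH1 W p U (eulerFactorOp (tateRep W p) U p σ c) =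
      aeval (frobeniusInvOp (W.torsionGaloisModule (p : ℤ)) U σ) Pbar (reduceH1 W p U c) :=
  reduceH1_aeval_frobeniusInvOp W p U σ hP c

/-! ## §4 The Euler factor of an `E`-split Frobenius modulo `p` is `(1 − X)²` -/

section Split

variable [W.IsGloballyMinimal]

omit [ContinuousSMul ℤ_[p] (W.tateModule p)] U in
/-- **`a_q ≡ 2 (mod p)` at an `E`-split Frobenius**: if an arithmetic Frobenius `Fr` at a good place
`v ∤ p` acts trivially on `E[p]`, then `a_v ≡ 2 (mod p)` — the trace of `ρ̄_{E,p}(Fr) = 1` on the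
`𝔽_p`-plane `E[p]` is `1 + χ̄_p(Fr) = 2` (`trace_galoisRepTorsion_eq_one_add_of_smul_eq`,
`modPCyclotomicCharacterZMod_eq_one_of_galoisRepTorsion_eq_one`) and equals `a_v mod p`
(`trace_galoisRepTorsion_frobenius_eq`, Serre (238)).  MU-TRANSFER-PROOF (F5): "`q` `E`-split ⟹
`a_q ≡ 2`". [cite: Serre1981, §8.1 eq. (238) (p. 188)] [cite: Serre1972, §1.11 and §5.2 (iii)] -/
theorem frobeniusTrace_eq_two_of_galoisRepTorsion_eq_one {v : HeightOneSpectrum (𝓞 ℚ)}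
    (hne : ((Rat.HeightOneSpectrum.primesEquiv v : Nat.Primes) : ℕ) ≠ p) (hgood : W.HasGoodReductionAt v)
    {𝔓 : Ideal (absIntegers (𝓞 ℚ) ℚ)} (h𝔓 : 𝔓 ∈ v.primesAbove) {Fr : absoluteGaloisGroup ℚ}
    (hFr : IsArithFrobAt (𝓞 ℚ) Fr 𝔓) (h1 : W.galoisRepTorsion p Fr = 1) :
    (W.frobeniusTrace (Rat.HeightOneSpectrum.primesEquiv v) : ZMod p) = 2 := by
  have hp : p.Prime := Fact.out
  set q : ℕ := ((Rat.HeightOneSpectrum.primesEquiv v : Nat.Primes) : ℕ) with hq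
  haveI : Fact q.Prime := ⟨(Rat.HeightOneSpectrum.primesEquiv v).2⟩
  have hgood' : W.HasGoodReductionAtPrime q :=
    (WeierstrassCurve.hasGoodReductionAtPrime_primesEquiv_iff_holds W v q rfl).mpr hgood
  -- a nonzero point of `E[p]` (`#E[p] = p²`), fixed by `Fr`
  have hcard : Nat.card (geomTorsion W (p : ℤ)) = p ^ 2 :=
    W.card_torsionPoints_eq_sq_holds (AlgebraicClosure ℚ) (by exact_mod_cast hp.ne_zero)
  haveI : Finite (geomTorsion W (p : ℤ)) := Nat.finite_of_card_ne_zero (by rw [hcard]; exact pow_ne_zero _ hp.ne_zero)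
  haveI : Nontrivial (geomTorsion W (p : ℤ)) :=
    Finite.one_lt_card_iff_nontrivial.mp (by rw [hcard]; exact Nat.one_lt_pow two_ne_zero hp.one_lt)
  obtain ⟨P, hP0⟩ := exists_ne (0 : geomTorsion W (p : ℤ))
  have hP : Fr • P = P := by rw [← WeierstrassCurve.galoisRepTorsion_apply, h1]; rfl
  have htr := W.trace_galoisRepTorsion_frobenius_eq p (p := q) hne hgood' rfl h𝔓 hFr
  have htr' := Literature.NumberTheory.Automorphic.Thorne2019.trace_galoisRepTorsion_eq_one_add_of_smul_eq W p Fr hP0 hP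
  rw [htr', SplitPrime.modPCyclotomicCharacterZMod_eq_one_of_galoisRepTorsion_eq_one W p h1,
    Units.val_one] at htr
  rw [← htr]
  norm_num

omit [ContinuousSMul ℤ_[p] (W.tateModule p)] U [W.IsGloballyMinimal] in
/-- **`q ≡ 1 (mod p)` at an `E`-split Frobenius** (x9 `SplitPrime.residueCard_eq_one_…` in the
`primesEquiv` spelling: `N(v) = q`). [cite: Serre1972, §1.11 and §5.2 (iii)] [cite: NeukirchANT1999, Ch. I (10.3)] -/
theorem primesEquiv_eq_one_of_galoisRepTorsion_eq_one {v : HeightOneSpectrum (𝓞 ℚ)}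
    (hne : ((Rat.HeightOneSpectrum.primesEquiv v : Nat.Primes) : ℕ) ≠ p)
    {𝔓 : Ideal (absIntegers (𝓞 ℚ) ℚ)} (h𝔓 : 𝔓 ∈ v.primesAbove) {Fr : absoluteGaloisGroup ℚ}
    (hFr : IsArithFrobAt (𝓞 ℚ) Fr 𝔓) (h1 : W.galoisRepTorsion p Fr = 1) :
    (((Rat.HeightOneSpectrum.primesEquiv v : Nat.Primes) : ℕ) : ZMod p) = 1 := by
  have hp : p.Prime := Fact.out
  have hpv : (p : 𝓞 ℚ) ∉ v.asIdeal := WeierstrassCurve.natCast_not_mem_asIdeal_of_primesEquiv_ne hp hne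
  have hp𝔓 : ((p : ℕ) : absIntegers (𝓞 ℚ) ℚ) ∉ 𝔓 := by
    intro h
    apply hpv
    rw [h𝔓.2.over, Ideal.under_def, Ideal.mem_comap, map_natCast]
    exact h
  have h := SplitPrime.residueCard_eq_one_of_isArithFrobAt_of_galoisRepTorsion_eq_one W p h𝔓 hp𝔓 hFr h1
  rwa [← WeierstrassCurve.natCard_residueField_eq_residueCard,
    WeierstrassCurve.natCard_residueField_adicCompletionIntegers] at h

omit U in
/-- **The Euler factor of an `E`-split Frobenius is `(1 − X)²` modulo `p`.**  At a good place `v ∤ p`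
with an arithmetic Frobenius `Fr` acting trivially on `E[p]`, Rubin's Euler factor
`P(Fr⁻¹ | T_pE*; X) = 1 − (a_q/q)X + (1/q)X²` (`Rat.rubinEulerFactor_galoisRepTate`) reduces to
`1 − 2X + X² = (1 − X)²` over `𝔽_p` (`a_q ≡ 2`, `q ≡ 1`).  MU-TRANSFER-PROOF (F5)/§3: this is what
makes the tame norm relation read `cores y = (Fr⁻¹ − 1)²·z` modulo `p`.
[cite: Rubin2000, Def. 2.1.1] [cite: Serre1981, §8.1 eq. (238) (p. 188)] -/
theorem map_toZMod_rubinEulerFactor_eq_of_galoisRepTorsion_eq_one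
    [Module.Free ℤ_[p] (W.tateModule p)] [Module.Finite ℤ_[p] (W.tateModule p)]
    {v : HeightOneSpectrum (𝓞 ℚ)} (hne : ((Rat.HeightOneSpectrum.primesEquiv v : Nat.Primes) : ℕ) ≠ p)
    (hgood : W.HasGoodReductionAt v) {Fr : absoluteGaloisGroup ℚ} (hFr : IsArithFrobAtPlace ℚ v Fr)
    (h1 : W.galoisRepTorsion p Fr = 1) :
    (rubinEulerFactor (tateRep W p).toRepresentation (cyclotomicCharacterToUnits ℚ p ℤ_[p]) Fr).map
        (PadicInt.toZMod (p := p)) = ((1 - X) ^ 2 : ℤ[X]).map (Int.castRingHom (ZMod p)) := by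
  obtain ⟨𝔓, h𝔓, hσ⟩ := hFr
  obtain ⟨u, hu, hP⟩ :=
    Summit.BirchSwinnertonDyer.Rank1Residual.GaloisImage.CyclotomicLevel.Rat.rubinEulerFactor_galoisRepTate
      W p hne hgood ⟨𝔓, h𝔓, hσ⟩
  have hq1 := primesEquiv_eq_one_of_galoisRepTorsion_eq_one W p hne h𝔓 hσ h1
  have ha2 := frobeniusTrace_eq_two_of_galoisRepTorsion_eq_one W p hne hgood h𝔓 hσ h1
  have hu1 : PadicInt.toZMod (u : ℤ_[p]) = 1 := by rw [hu, map_natCast, hq1]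
  have hui : PadicInt.toZMod (↑u⁻¹ : ℤ_[p]) = 1 := by
    have h := congrArg (PadicInt.toZMod (p := p)) (u.inv_mul : (↑u⁻¹ : ℤ_[p]) * ↑u = 1)
    rwa [map_mul, hu1, mul_one, map_one] at h
  have hcoef : PadicInt.toZMod
      ((↑u⁻¹ : ℤ_[p]) * (W.frobeniusTrace (Rat.HeightOneSpectrum.primesEquiv v) : ℤ_[p])) = 2 := by
    rw [map_mul, hui, one_mul, map_intCast, ha2]
  change (rubinEulerFactor (W.galoisRepTate p) (cyclotomicCharacterToUnits ℚ p ℤ_[p]) Fr).map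
    PadicInt.toZMod = _
  rw [hP]
  simp only [Polynomial.map_add, Polynomial.map_sub, Polynomial.map_one, Polynomial.map_mul,
    Polynomial.map_pow, Polynomial.map_X, Polynomial.map_C, hcoef, hui]
  -- `1 - C 2 * X + C 1 * X ^ 2 = (1 - X) ^ 2`
  rw [map_one, one_mul, show (C (2 : ZMod p) : (ZMod p)[X]) = 2 from map_ofNat C 2]
  ring

end Split

/-! ## §5 Operator form: `P̄((1+S)^{pᵐu}) = S^{2pᵐ}·(unit)` on `𝒯_J` -/

section Operator

variable {M : Type*} [AddCommGroup M] {J : ℕ}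

omit [W.IsElliptic] [ContinuousSMul ℤ_[p] (W.tateModule p)] U in
/-- Integer polynomials congruent modulo `p` induce the same operator on a `p`-torsion module
(`p = 0` in `End(Fin J → M)`). [folklore] -/
theorem aeval_eq_aeval_of_map_castRingHom_eq (hM : ∀ x : M, p • x = 0) (T : Module.End ℤ (Fin J → M))
    {P Q : ℤ[X]} (h : P.map (Int.castRingHom (ZMod p)) = Q.map (Int.castRingHom (ZMod p))) :
    aeval T P = aeval T Q := by
  rw [← sub_eq_zero, ← map_sub]
  have hcoeff : ∀ i, (p : ℤ) ∣ (P - Q).coeff i := fun i => by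
    have hi := congrArg (fun R : (ZMod p)[X] => R.coeff i) h
    simp only [coeff_map, Int.coe_castRingHom] at hi
    rw [coeff_sub]
    exact (ZMod.intCast_eq_intCast_iff_dvd_sub _ _ _).mp hi.symm
  rw [aeval_eq_sum_range]
  refine Finset.sum_eq_zero fun i _ => ?_
  obtain ⟨k, hk⟩ := hcoeff i
  rw [hk, Algebra.smul_def, eq_intCast, Int.cast_mul, Int.cast_natCast,
    LocalSplitPrime.natCast_prime_end_eq_zero (J := J) hM, zero_mul, zero_mul]

omit [W.IsElliptic] [ContinuousSMul ℤ_[p] (W.tateModule p)] U in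
/-- **The reduced Euler factor at `(1+S)^{pᵐu}` is `S^{2pᵐ}` times a unit.**  On `Fin J → M` with
`p·M = 0`, for `p ∤ u` and any `P̄ ∈ ℤ[X]` reducing to `(1 − X)²` modulo `p`:
`P̄((1+S)^{pᵐ·u}) = S^{2pᵐ}·V` with `V` a unit commuting with `S` — from koly's (F5)
`(1+S)^{pᵐu} − 1 = S^{pᵐ}·(unit)` squared.  With `(1+S)^{pᵐu} ↔ Fr⁻¹` under Shapiro
(`coresShapiro_conjMap`) for an `E`-split `Fr` of depth `m`, this is "`P̄_Fr(g⁻¹) = u(S)·S^{2pᵐ}`,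
`p ∤ u(0)`" of the G3a plan. [cite: Washington1997, §13.2 (arithmetic in Λ/(p, T^n))] -/
theorem exists_aeval_unipotentPow_eq_shiftEnd_pow_mul_unit (hM : ∀ x : M, p • x = 0) (m u : ℕ)
    (hu : ¬ p ∣ u) {Pbar : ℤ[X]}
    (hPbar : Pbar.map (Int.castRingHom (ZMod p)) = ((1 - X) ^ 2 : ℤ[X]).map (Int.castRingHom (ZMod p))) :
    ∃ V : Module.End ℤ (Fin J → M), IsUnit V ∧ Commute (shiftEnd M J) V ∧
      aeval (unipotentPow M J (p ^ m * u)) Pbar = shiftEnd M J ^ (2 * p ^ m) * V := by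
  obtain ⟨V, hV, hSV, hVeq⟩ :=
    LocalSplitPrime.unipotentPow_sub_one_eq_shiftEnd_pow_mul_unit (J := J) hM m u hu
  refine ⟨V * V, hV.mul hV, hSV.mul_right hSV, ?_⟩
  have hcomm : V * shiftEnd M J ^ (p ^ m) = shiftEnd M J ^ (p ^ m) * V := (hSV.pow_left (p ^ m)).eq.symm
  rw [aeval_eq_aeval_of_map_castRingHom_eq p hM _ hPbar, map_pow, map_sub, map_one, aeval_X,
    ← neg_sub, neg_sq, hVeq, sq, mul_assoc, ← mul_assoc V, hcomm, mul_assoc, ← mul_assoc, ← pow_add,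
    ← two_mul]

end Operator

end Summit.BirchSwinnertonDyer.BirchSwinnertonDyer.Rank1Residual.EulerFactorModP

end
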